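import Summits.QuantumFields.BalabanUV.T4Continuum.Support.CovariantMeanSupply

/-!
# T⁴ programme, spine node NE1′ (O3b/H2) — THE REPRESENTATION IDENTITY EXCLUDES THE EMPTY TERM REPRESENTATION: every
# `TermRep` of a realised renormalisation step of ANY finite-ε datum has total piece mass `∫ρ₀ = c·Z_ε > 0` and therefore a
# NON-EMPTY index; in particular the slot structure `CovariantMeanContraction.StepSupply` of the merged NE1′ road P3/P4 never
# quantifies over an empty family of terms

Cell `pub-balaban`, unit `b2b-balaban-t4-ne1p-p3` (ROUND-2 technique-distinct prover #3 on BINDER row NE1′, merged with road P4 as supplier,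
journal l.5166/5175/5206; t4-ref2 PASS 60 C-t4r2-304 (1)), generation 30.  OUR bookkeeping (new work ⇒ `Summits/`), tree
vocabulary BY NAME (`T4UniformDefectWiring.TermRep` — this lineage's generation-5 structure —, `T4Continuum.FiniteEpsData`,
`T4Spectator.rho`/`integral_rho_pos`, `CovariantMeanContraction.StepSupply` p207717); everything is PROVED; no `def … : Prop`; nothing
of T. Bałaban's series is asserted or cited beyond the certified headers of the modules used.

HONEST FRAMING (T4-DAG p. 1).  Rung (B)+1 on ONE finite four-torus of fixed physical size; NOT infinite volume, NOT a mass gap,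
NOT the Clay problem, NOT summit progress.  WHAT THIS ANSWERS: the referee's trigger condition for row NE1′ asks for «a NON-VACUITY
witness of `StepSupply` for a non-empty `TermRep` (the slot inequalities are sums over the rep's index; the representation identity
of `TermRep` must be what excludes the empty rep — state it in the skeleton or land a witness)» (t4-ref2 PASS 60, journal l.5803).
This file lands the PARENTHETICAL for EVERY datum: the representation identity `TermRep.sum_eq` («(0.2): the density is the sum of its
pieces») together with the dictionary of `FiniteEpsData` (`∫Tρ_k = ∫ρ_k = ∫ρ₀ = c·Z_ε`, `c > 0`, `Z_ε > 0` on a regular gauge group)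
forces `Σ_Z ∫piece_Z = c·Z_ε > 0`, hence a NON-EMPTY index type, for every `TermRep` of a realised step `Tρ_k` and so for the
field `ρr` of every `StepSupply D g₀ Cs 𝔣 k n`.  WHAT IT DOES NOT DO: it does NOT construct an inhabitant of `StepSupply` (the
witness (n6) designed by road P4 over `T4FiniteEpsInhabited.stubData` — one self-partnered term with a non-empty fibre — is a separate
item; its obstruction «pointwise `TermProvisos` versus a.e.-defined Radon–Nikodym transports» is recorded in the cell journal), and it
proves NO estimate.  HONEST DEPENDENCY (verbatim): continuum YM on T⁴ ⇐ BetaPertH ∧ nine spine estimates (0/9 proved); BetaPertH ⇐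
(D1) ∧ (D4) ∧ CAP+tail; G-an2-4 gates asym, D1 and NE2/3/4.

WHAT IS PROVED ([folklore]).
* `TermRep.nonempty_index_of_integral_ne_zero` — `∫σ ≠ 0 ⇒ Nonempty ι` (from this lineage's mass identity
  `T4UniformDefectWiring.TermRep.sum_integral_piece`: `Σ_Z ∫piece_Z dV = ∫σ dV`, BY NAME);
* `FiniteEpsData.integral_Trho_pos` — `∫Tρ_k dV > 0` for `k < K` (`T4UniformDefectWiring.integral_Trho_eq` + `T4Spectator.integral_rho_pos`,
  BY NAME; the gate's dedup lint kept this file from re-proving either);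
* `StepSupply.sum_mass_eq` — for every slot structure the total mass of its terms IS the run's mass `∫ρ_K` appearing on the right of
  `massCount`; `StepSupply.nonempty_index` — its term family is non-empty.
-/

noncomputable section

open MeasureTheory
open scoped BigOperators

namespace Summit.QuantumFields.BalabanUV.T4Continuum.NE1pTermRepNonvacuous

open Literature.MathematicalPhysics.QuantumFieldTheory.Balaban1983to89
open T4Continuum T4UniformDefectWiring T4ObservableTelescope T4Spectator Missing
open Summit.QuantumFields.BalabanUV.T4Continuum.CovariantMeanContraction

/-! ## §1 The representation identity integrated: total piece mass, non-empty index -/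

section Rep

variable {P : Params} {j : ℕ} {G : Type*} [GaugeGroup G] [MeasurableSpace G] [HaarData G]
variable [DecidableEq (PBond P j)]
variable {σ : Density P j G} {Rj : Density P j G → Density P j G} (ρr : TermRep σ Rj)

/-- **THE REPRESENTATION IDENTITY EXCLUDES THE EMPTY REPRESENTATION**: a density of non-zero mass has no term representation with
an empty index type. [folklore] -/
theorem TermRep.nonempty_index_of_integral_ne_zero (h : ∫ V, σ V ∂fieldMeasure P j G ≠ 0) : Nonempty ρr.ι := by
  by_contra hι
  rw [not_nonempty_iff] at hι
  apply h
  rw [← ρr.sum_integral_piece]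
  exact Finset.sum_of_isEmpty _

end Rep

/-! ## §2 The dictionary: the transform `Tρ_k` of a realised step has the run's (positive) mass -/

section Data

variable {F : T4Family} {G : Type*} [GaugeGroup G] [MeasurableSpace G] [HaarData G]

/-- **`∫Tρ_k > 0`** on a regular gauge group (`∫Tρ_k = ∫ρ_K` is this lineage's `T4UniformDefectWiring.integral_Trho_eq`; `∫ρ_K = c·Z_ε > 0` is `T4Spectator.integral_rho_pos`). [folklore] -/
theorem FiniteEpsData.integral_Trho_pos [RegularGaugeGroup G] (D : FiniteEpsData F G) (K : ℕ) (g₀ : ℝ) {k : ℕ} (hk : k < K) :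
    0 < ∫ V, D.real.Trho K g₀ k V ∂fieldMeasure (F.P K) (k + 1) G := by
  rw [integral_Trho_eq D K g₀ hk]
  exact integral_rho_pos D K g₀

/-- Every term representation of a realised step of a finite-ε datum on a regular gauge group has a NON-EMPTY index. [folklore] -/
theorem FiniteEpsData.nonempty_index_termRep [RegularGaugeGroup G] [∀ K j : ℕ, DecidableEq (PBond (F.P K) j)]
    (D : FiniteEpsData F G) (K : ℕ) (g₀ : ℝ) {k : ℕ} (hk : k < K)
    (ρr : TermRep (D.real.Trho K g₀ k) (D.real.R K g₀ k)) : Nonempty ρr.ι :=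
  TermRep.nonempty_index_of_integral_ne_zero ρr (FiniteEpsData.integral_Trho_pos D K g₀ hk).ne'

end Data

/-! ## §3 Consequence for the merged road's slot structure -/

section Slots

variable {F : T4Family} {G : Type*} [GaugeGroup G] [MeasurableSpace G] [HaarData G]
variable [∀ K j : ℕ, DecidableEq (PBond (F.P K) j)]
variable {D : FiniteEpsData F G} {g₀ : ℕ → ℝ} {Cs : List (ULoop F)} {𝔣 : Factors} {k n : ℕ}

/-- **THE SLOTS' MASSES ARE PINNED**: the total mass of the terms of a `StepSupply` equals the run's mass `∫ρ_K`, `K = k+1+n` —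
the number multiplying the right-hand side of `massCount`. [folklore] -/
theorem StepSupply.sum_mass_eq (σ : StepSupply D g₀ Cs 𝔣 k n) :
    ∑ Z, ∫ V, σ.ρr.piece Z V ∂fieldMeasure (F.P (k + 1 + n)) (k + 1) G
      = ∫ V, rho D (k + 1 + n) (g₀ (k + 1 + n)) (k + 1 + n) V ∂fieldMeasure (F.P (k + 1 + n)) (k + 1 + n) G := by
  rw [σ.ρr.sum_integral_piece]
  exact integral_Trho_eq D (k + 1 + n) (g₀ (k + 1 + n)) (by omega)

/-- **NO `StepSupply` HAS AN EMPTY FAMILY OF TERMS** (regular gauge group): the slot inequalities are never sums over an empty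
index. [folklore] -/
theorem StepSupply.nonempty_index [RegularGaugeGroup G] (σ : StepSupply D g₀ Cs 𝔣 k n) : Nonempty σ.ρr.ι :=
  FiniteEpsData.nonempty_index_termRep D (k + 1 + n) (g₀ (k + 1 + n)) (by omega) σ.ρr

/-- Hence the total mass of the terms of a `StepSupply` is STRICTLY POSITIVE (regular gauge group). [folklore] -/
theorem StepSupply.sum_mass_pos [RegularGaugeGroup G] (σ : StepSupply D g₀ Cs 𝔣 k n) :
    0 < ∑ Z, ∫ V, σ.ρr.piece Z V ∂fieldMeasure (F.P (k + 1 + n)) (k + 1) G := by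
  rw [StepSupply.sum_mass_eq σ]
  exact integral_rho_pos D (k + 1 + n) (g₀ (k + 1 + n))

end Slots

end Summit.QuantumFields.BalabanUV.T4Continuum.NE1pTermRepNonvacuous
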